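import Literature.Geometry.Kaehler.HolomorphicChainBlowUpPiece

/-!
# Continuity of the blow-ups of a holomorphic chain in the radius

For a holomorphic `p`-chain `T` on `Ω`, a base point `b` with `𝐁(b, R) ⊆ Ω` and a test form `φ`
on the unit ball, **`r ↦ D_r(φ)` is continuous on `(0, R)`**
(`HolomorphicChain.continuousOn_blowUp_apply`), where `D_r = (1/r)_*(τ_{-b})_*[T]`
(`HolomorphicChain.blowUp`). Indeed, by the change of variables `x = b + r y`
(`HolomorphicChain.blowUp_apply_eq_setIntegral`),

`D_r(φ) = r^{-2p} ∫_{reg|T| ∩ B(b,R)} ⟨θ_T ξ_T, φ((x − b)/r)⟩ d𝓗^{2p}(x)`,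

an integral over a fixed set of a jointly continuous-in-`r`, dominated (`≤ |θ_T| sup ‖φ‖`)
integrand: dominated convergence. This continuity makes the (integer) sheet numbers of the
blow-ups over the windows of the tangent cone independent of `r` (King's tangent cone theorem).

Theorems only; no named facts.

## References

* H. Federer, *Geometric Measure Theory*, Springer 1969, 4.3.16 [Federer1969].
* R. Harvey, *Holomorphic chains and their boundaries*, PSPUM XXX.1 (1977), §1.10 [Harvey1977].
-/

noncomputable section

open scoped Manifold Topology ENNReal NNReal
open Set Filter MeasureTheory Metric Function TopologicalSpace

namespace Literature.Geometry.Kaehler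

open Literature.Geometry.GeometricMeasureTheory

-- Nested operator-norm instances on (duals of) `V [⋀^Fin n]→L[ℝ] ℝ`.
set_option maxSynthPendingDepth 2

namespace HolomorphicChain

universe u

variable {V : Type u} [NormedAddCommGroup V] [InnerProductSpace ℂ V] [FiniteDimensional ℂ V]
  [MeasurableSpace V] [BorelSpace V] {Ω : Opens V} {p : ℕ}

/-- The density-weighted orientation field `η_T = θ_T ξ_T` of the chain. [cite: Federer1969, 4.1.28] -/
def densityField (T : HolomorphicChain 𝓘(ℂ, V) Ω p) (x : V) : Multivector V (2 * p) :=
  letI : NormedSpace ℝ V := NormedSpace.complexToReal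
  (T.density x : ℝ) • frameVector (T.orientationFrame x)

/-- **The blow-up as an integral over the original chain**:
`D_r(φ) = r^{-2p} ∫_{reg|T| ∩ B(b,r)} ⟨η_T(x), φ((x − b)/r)⟩ d𝓗^{2p}(x)`. [cite: Harvey1977, §1.10] -/
theorem blowUp_apply_eq_setIntegral (T : HolomorphicChain 𝓘(ℂ, V) Ω p) {b : V} {r : ℝ} (hr : 0 < r)
    (hball : ball b r ⊆ (Ω : Set V)) (φ : TestForm (unitBall V) (2 * p)) :
    T.blowUp b r φ = r⁻¹ ^ (2 * p) *
      ∫ x in T.carrier ∩ ball b r, T.densityField x (φ (r⁻¹ • (x - b))) ∂(μHE[2 * p] : Measure V) := by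
  letI : InnerProductSpace ℝ V := InnerProductSpace.complexToReal
  have hT := Harvey1977_isRectifiableData_toCurrent_holds V Ω p T
  have h1 : IsRectifiableData (unitBall V) (2 * p) (T.blowUpSet b r ∩ ball (0 : V) 1)
      (T.blowUpDensity b r) (T.blowUpFrame b r) := T.isRectifiableData_blowUp hT hr hball
  rw [blowUp_eq, currentOfIntegration_apply h1.2.2.2.1]
  -- the carrier of `D_r` is `A⁻¹(reg|T| ∩ B(b,r))`, `A y = b + r • y`
  have hset : T.blowUpSet b r ∩ ball (0 : V) 1 = (fun y : V => b + r • y) ⁻¹' (T.carrier ∩ ball b r) := by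
    have := T.blowUpSet_inter_ball b hr 0 1
    simpa using this
  rw [hset]
  let eA : V ≃ᵐ V :=
    ((Homeomorph.smulOfNeZero r hr.ne').trans (Homeomorph.addLeft b)).toMeasurableEquiv
  have heA : ⇑eA = fun y : V => b + r • y := rfl
  have hinv : ∀ y : V, r⁻¹ • (b + r • y - b) = y := fun y => by
    rw [add_sub_cancel_left, smul_smul, inv_mul_cancel₀ hr.ne', one_smul]
  set f : V → ℝ := fun x => T.densityField x (φ (r⁻¹ • (x - b))) with hf
  have h2 : (fun y : V => (T.blowUpDensity b r y : ℝ) * φ y (T.blowUpFrame b r y)) = f ∘ eA := by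
    funext y
    simp only [hf, comp_apply, heA, hinv, densityField, blowUpDensity, blowUpFrame,
      _root_.smul_apply, frameVector_apply, smul_eq_mul]
  rw [h2]
  have h3 : ∫ y in (fun y : V => b + r • y) ⁻¹' (T.carrier ∩ ball b r), (f ∘ eA) y ∂(μHE[2 * p] : Measure V) =
      ∫ x, f x ∂(Measure.map eA ((μHE[2 * p] : Measure V).restrict
        ((fun y : V => b + r • y) ⁻¹' (T.carrier ∩ ball b r)))) := by
    rw [integral_map_equiv]
    rfl
  rw [h3, heA, map_add_smul_restrict_preimage b hr, integral_smul_measure, ENNReal.toReal_ofReal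
    (pow_nonneg (inv_nonneg.2 hr.le) _), smul_eq_mul]

omit [FiniteDimensional ℂ V] [MeasurableSpace V] [BorelSpace V] in
/-- Test forms on the unit ball vanish outside the unit ball. [folklore] -/
theorem testForm_apply_eq_zero_of_one_le {m : ℕ} (φ : TestForm (unitBall V) m) {y : V} (hy : 1 ≤ ‖y‖) :
    φ y = 0 := by
  refine image_eq_zero_of_notMem_tsupport fun h => ?_
  have := φ.tsupport_subset h
  simp only [unitBall, Opens.coe_mk, mem_ball_zero_iff] at this
  linarith

/-- **The blow-up integral over a fixed ball**: for `0 < r ≤ R`, `B(b,R) ⊆ Ω`,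
`D_r(φ) = r^{-2p} ∫_{reg|T| ∩ B(b,R)} ⟨η_T(x), φ((x − b)/r)⟩ d𝓗^{2p}(x)` (the integrand vanishes
off `B(b, r)`). [cite: Harvey1977, §1.10] -/
theorem blowUp_apply_eq_setIntegral_of_le (T : HolomorphicChain 𝓘(ℂ, V) Ω p) {b : V} {r R : ℝ}
    (hr : 0 < r) (hrR : r ≤ R) (hball : ball b R ⊆ (Ω : Set V)) (φ : TestForm (unitBall V) (2 * p)) :
    T.blowUp b r φ = r⁻¹ ^ (2 * p) *
      ∫ x in T.carrier ∩ ball b R, T.densityField x (φ (r⁻¹ • (x - b))) ∂(μHE[2 * p] : Measure V) := by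
  rw [T.blowUp_apply_eq_setIntegral hr ((ball_subset_ball hrR).trans hball) φ]
  congr 1
  symm
  refine setIntegral_eq_of_subset_of_forall_sdiff_eq_zero
    (T.measurableSet_carrier.inter measurableSet_ball) (inter_subset_inter_right _ (ball_subset_ball hrR)) ?_
  intro x hx
  have hxr : x ∉ ball b r := fun h => hx.2 ⟨hx.1.1, h⟩
  rw [mem_ball, dist_eq_norm, not_lt] at hxr
  have h1 : 1 ≤ ‖r⁻¹ • (x - b)‖ := by
    rw [norm_smul, norm_inv, Real.norm_of_nonneg hr.le, le_inv_mul_iff₀ hr, mul_one]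
    exact hxr
  rw [testForm_apply_eq_zero_of_one_le φ h1, map_zero]

/-- The density field is a.e. strongly measurable and `|θ_T|` is integrable on
`reg|T| ∩ B(b, R)` when `𝐁(b, R) ⊆ Ω`. [cite: Federer1969, 4.1.28] -/
theorem integrableOn_densityField (T : HolomorphicChain 𝓘(ℂ, V) Ω p) {b : V} {R : ℝ}
    (hball : closedBall b R ⊆ (Ω : Set V)) :
    IntegrableOn T.densityField (T.carrier ∩ ball b R) (μHE[2 * p] : Measure V) := by
  letI : InnerProductSpace ℝ V := InnerProductSpace.complexToReal
  haveI : FiniteDimensional ℝ V := FiniteDimensional.complexToReal V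
  haveI : ProperSpace V := FiniteDimensional.proper ℝ V
  have hT := Harvey1977_isRectifiableData_toCurrent_holds V Ω p T
  have hint := hT.2.2.2.1
  have h1 : IntegrableOn T.densityField (closedBall b R) ((μHE[2 * p] : Measure V).restrict T.carrier) :=
    hint.integrableOn_compact_subset hball (isCompact_closedBall b R)
  rw [IntegrableOn, Measure.restrict_restrict measurableSet_closedBall, inter_comm] at h1
  exact IntegrableOn.mono_set h1 (inter_subset_inter_right _ ball_subset_closedBall)

/-- `‖η_T(x)‖ ≤ |θ_T(x)|` a.e. on the carrier (the frames are a.e. orthonormal). [cite: Federer1969, 4.1.28] -/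
theorem ae_norm_densityField_le (T : HolomorphicChain 𝓘(ℂ, V) Ω p) :
    ∀ᵐ x ∂((μHE[2 * p] : Measure V).restrict T.carrier), ‖T.densityField x‖ ≤ |(T.density x : ℝ)| := by
  letI : InnerProductSpace ℝ V := InnerProductSpace.complexToReal
  have hT := Harvey1977_isRectifiableData_toCurrent_holds V Ω p T
  filter_upwards [hT.2.2.2.2] with x hx
  rw [densityField, norm_smul, Real.norm_eq_abs]
  exact mul_le_of_le_one_right (abs_nonneg _) (norm_frameVector_le_one hx.1)

/-- **Continuity of `r ↦ D_r(φ)` on `(0, R)`** when `𝐁(b, R) ⊆ Ω` (dominated convergence).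
[cite: Federer1969, 4.3.16; Harvey1977, §1.10] -/
theorem continuousOn_blowUp_apply (T : HolomorphicChain 𝓘(ℂ, V) Ω p) {b : V} {R : ℝ}
    (hball : closedBall b R ⊆ (Ω : Set V)) (φ : TestForm (unitBall V) (2 * p)) :
    ContinuousOn (fun r => T.blowUp b r φ) (Ioo 0 R) := by
  letI : InnerProductSpace ℝ V := InnerProductSpace.complexToReal
  have hballo : ball b R ⊆ (Ω : Set V) := ball_subset_closedBall.trans hball
  set S : Set V := T.carrier ∩ ball b R with hS
  set μ : Measure V := (μHE[2 * p] : Measure V).restrict S with hμ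
  -- the integrand and its continuity in `r`
  set F : ℝ → V → ℝ := fun r x => T.densityField x (φ (r⁻¹ • (x - b))) with hF
  have heq : ∀ r ∈ Ioo 0 R, T.blowUp b r φ = r⁻¹ ^ (2 * p) * ∫ x, F r x ∂μ := fun r hr =>
    T.blowUp_apply_eq_setIntegral_of_le hr.1 hr.2.le hballo φ
  have hcont : ContinuousOn (fun r => r⁻¹ ^ (2 * p) * ∫ x, F r x ∂μ) (Ioo 0 R) := by
    refine ContinuousOn.mul ((continuousOn_inv₀.mono fun r hr => ne_of_gt hr.1).pow _) ?_
    -- dominated convergence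
    obtain ⟨C, hC⟩ := φ.continuous.bounded_above_of_compact_support φ.hasCompactSupport
    have hint := T.integrableOn_densityField hball
    have hmeasη : AEStronglyMeasurable T.densityField μ := hint.aestronglyMeasurable
    refine continuousOn_of_dominated (bound := fun x => |(T.density x : ℝ)| * C) ?_ ?_ ?_ ?_
    · intro r _
      have hg : Continuous fun x : V => φ (r⁻¹ • (x - b)) :=
        φ.continuous.comp ((continuous_id.sub continuous_const).const_smul _)
      exact ContinuousLinearMap.aestronglyMeasurable_comp₂
        (ContinuousLinearMap.id ℝ (Multivector V (2 * p))) hmeasη hg.aestronglyMeasurable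
    · intro r _
      have h1 : ∀ᵐ x ∂μ, ‖T.densityField x‖ ≤ |(T.density x : ℝ)| :=
        ae_mono (Measure.restrict_mono inter_subset_left le_rfl) T.ae_norm_densityField_le
      filter_upwards [h1] with x hx
      calc ‖F r x‖ ≤ ‖T.densityField x‖ * ‖φ (r⁻¹ • (x - b))‖ := ContinuousLinearMap.le_opNorm _ _
        _ ≤ |(T.density x : ℝ)| * C :=
          mul_le_mul hx (hC _) (norm_nonneg _) (abs_nonneg _)
    · -- `|θ| C` is integrable on `S`
      have hC0 : 0 ≤ C := (norm_nonneg _).trans (hC 0)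
      have h1 : ∀ᵐ x ∂μ, ‖T.densityField x‖ = |(T.density x : ℝ)| := by
        have hT := Harvey1977_isRectifiableData_toCurrent_holds V Ω p T
        filter_upwards [ae_mono (Measure.restrict_mono inter_subset_left le_rfl) hT.2.2.2.2] with x hx
        rw [densityField, norm_smul, Real.norm_eq_abs, norm_frameVector_eq_one hx.1, mul_one]
      have h2 : Integrable (fun x => |(T.density x : ℝ)|) μ := by
        refine hint.norm.congr ?_
        filter_upwards [h1] with x hx using hx
      exact h2.mul_const C
    · refine Eventually.of_forall fun x => ?_
      have h1 : ContinuousOn (fun r : ℝ => r⁻¹ • (x - b)) (Ioo 0 R) :=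
        ((continuousOn_inv₀.mono fun r hr => ne_of_gt hr.1).smul continuousOn_const)
      exact ((T.densityField x).continuous.comp_continuousOn (φ.continuous.comp_continuousOn h1))
  exact hcont.congr heq

end HolomorphicChain

end Literature.Geometry.Kaehler
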